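import Summits.QuantumFields.GaugeBoot.SpecialUnitaryHaarPrep
import HarnessLib

/-!
# Gauge-boot: two-sided small-ball bounds for Haar measure on `SU(N)` with the right exponent
# `N² − 1`, via `U(1) × SU(N) → U(N)` (supplement 21, part 3b, file 2/2)

HONEST FRAMING (cell `pub-gaugeboot`, page 1 of every file): certified bounds on lattice
expectations at STATED coupling, gauge group, dimension and torus size; NOT a mass gap, NOT a
continuum limit, NOT a string tension, NOT large `N`; NOT Yang–Mills-summit-bearing (barriers
`FixedCouplingUltralocality`, `PerturbativeInvisibility`).  Pure measure theory on compact groups;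
it certifies no number.  Input of the explicit-constant `O(1/β)` bound of parts 3c–3e.

## Content

With `m(z, V) = zV : U(1) × SU(N) → U(N)` and the left-invariant probability measure
`m_*(Haar ⊗ Haar)` of file 1/2, to which the tree's covering bound `haar_unitaryOpBall_ge` and part
3a's packing bound `HaarPacking.haar_unitaryOpBall_le` apply (no Haar uniqueness on `U(N)` needed):

* ★★ `SUHaar.haar_suOpBall_le` — **UPPER**: for `N ≥ 1` and `0 < ρ ≤ π`,
  `ν{V ∈ SU(N) : ‖V − 1‖_op ≤ ρ} ≤ (π/ρ) (20ρ)^{N²} = 20^{N²} π ρ^{N² − 1}`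
  (`{|z − 1| ≤ ρ} × B_ρ ⊆ m⁻¹ B_{2ρ}` and `λ{|z − 1| ≤ ρ} ≥ ρ/π`);
* ★★ `SUHaar.haar_suOpBall_ge'` — **LOWER**: for `N ≥ 1` and `0 < ρ < 2`,
  `ν{V ∈ SU(N) : ‖V − 1‖_op ≤ 2ρ} ≥ (4/(Nπρ)) (ρ/(2π + ρ))^{N²}` (the `z`-section of `m⁻¹ B_ρ` is a
  left translate of a subset of `B_{2ρ}`, and is empty unless `|z^N − 1| ≤ Nπρ/2`, an arc of Haar
  measure `≤ Nπρ/4` since `z ↦ z^N` preserves Haar measure).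

So the Haar measure of `SU(N)` is exactly `(N² − 1)`-dimensional at the identity, with explicit
`N`-dependent constants and no Weyl integration formula.  [folklore] (S. Szarek, Banach Center Publ. 43
(1998); everything is proved from Mathlib and the tree.)
-/

open Complex NormedSpace selfAdjoint Unitary MeasureTheory
open scoped Real Matrix.Norms.L2Operator Pointwise ENNReal NNReal
open Literature.Barriers.QuantumFields
open Literature.MathematicalPhysics.QuantumFieldTheory (haarProbability)

noncomputable section

namespace Summit.QuantumFields.GaugeBoot

namespace SUHaar

/-! ### The two-sided small-ball bound on `SU(N)` -/

section SmallBall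
variable {N : ℕ}

/-- The closed operator-norm ball of `SU(N)` around the identity. -/
def suOpBall (N : ℕ) (ρ : ℝ) : Set (Matrix.specialUnitaryGroup (Fin N) ℂ) :=
  {V | ‖(V : Matrix (Fin N) (Fin N) ℂ) - 1‖ ≤ ρ}

/-- The ball is closed, hence measurable. [folklore] -/
theorem measurableSet_suOpBall (ρ : ℝ) : MeasurableSet (suOpBall N ρ) :=
  (isClosed_le ((continuous_subtype_val.sub continuous_const).norm) continuous_const).measurableSet

/-- `‖V‖_op = 1` for `V ∈ SU(N)`, `N ≥ 1`. [folklore] -/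
theorem norm_coe_su (hN : N ≠ 0) (V : Matrix.specialUnitaryGroup (Fin N) ℂ) : ‖(V : Matrix (Fin N) (Fin N) ℂ)‖ = 1 := by
  haveI : Nonempty (Fin N) := ⟨⟨0, Nat.pos_of_ne_zero hN⟩⟩
  exact CStarRing.norm_of_mem_unitary (Matrix.mem_specialUnitaryGroup_iff.1 V.2).1

/-- `{|z − 1| ≤ ρ} × B^{SU}_ρ ⊆ m⁻¹ B^{U}_{2ρ}` (`‖zV − 1‖ ≤ |z − 1|‖V‖ + ‖V − 1‖`). [folklore] -/
theorem arc_prod_suOpBall_subset (hN : N ≠ 0) (ρ : ℝ) :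
    {z : Circle | ‖(z : ℂ) - 1‖ ≤ ρ} ×ˢ suOpBall N ρ ⊆ toUnitary ⁻¹' unitaryOpBall N (2 * ρ) := by
  rintro ⟨z, V⟩ ⟨hz, hV⟩
  simp only [Set.mem_setOf_eq, suOpBall] at hz hV
  rw [Set.mem_preimage, mem_unitaryOpBall, coe_toUnitary]
  have h1 : (z : ℂ) • (V : Matrix (Fin N) (Fin N) ℂ) - 1 =
      ((z : ℂ) - 1) • (V : Matrix (Fin N) (Fin N) ℂ) + ((V : Matrix (Fin N) (Fin N) ℂ) - 1) := by
    rw [sub_smul, one_smul]; abel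
  rw [h1]
  calc ‖((z : ℂ) - 1) • (V : Matrix (Fin N) (Fin N) ℂ) + ((V : Matrix (Fin N) (Fin N) ℂ) - 1)‖
      ≤ ‖((z : ℂ) - 1) • (V : Matrix (Fin N) (Fin N) ℂ)‖ + ‖(V : Matrix (Fin N) (Fin N) ℂ) - 1‖ := norm_add_le _ _
    _ = ‖(z : ℂ) - 1‖ * 1 + ‖(V : Matrix (Fin N) (Fin N) ℂ) - 1‖ := by rw [norm_smul, norm_coe_su hN]
    _ ≤ ρ * 1 + ρ := by gcongr
    _ = 2 * ρ := by ring

/-- ★★ **UPPER small-ball bound on `SU(N)`**: for `N ≥ 1` and `0 < ρ ≤ π`,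
`ν{V ∈ SU(N) : ‖V − 1‖_op ≤ ρ} ≤ (π/ρ) · (20ρ)^{N²}` (`= 20^{N²} π ρ^{N² − 1}`). [folklore] -/
theorem haar_suOpBall_le (hN : N ≠ 0) {ρ : ℝ} (hρ : 0 < ρ) (hρπ : ρ ≤ π) :
    haarProbability (Matrix.specialUnitaryGroup (Fin N) ℂ) (suOpBall N ρ) ≤
      ENNReal.ofReal (π / ρ * (20 * ρ) ^ (N * N)) := by
  set lam := haarProbability Circle
  set ν := haarProbability (Matrix.specialUnitaryGroup (Fin N) ℂ)
  haveI := secondCountable_su N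
  haveI := isProbabilityMeasure_prodHaar N
  haveI := isMulLeftInvariant_prodHaar hN
  have hU : prodHaar N (unitaryOpBall N (2 * ρ)) ≤ ENNReal.ofReal ((10 * (2 * ρ)) ^ (N * N)) :=
    HaarPacking.haar_unitaryOpBall_le _ (by positivity)
  have hprod : lam {z : Circle | ‖(z : ℂ) - 1‖ ≤ ρ} * ν (suOpBall N ρ) ≤ prodHaar N (unitaryOpBall N (2 * ρ)) := by
    rw [← Measure.prod_prod, prodHaar, Measure.map_apply continuous_toUnitary.measurable (measurableSet_unitaryOpBall _)]
    exact measure_mono (arc_prod_suOpBall_subset hN ρ)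
  have harc : ENNReal.ofReal (ρ / π) ≤ lam {z : Circle | ‖(z : ℂ) - 1‖ ≤ ρ} := haar_circle_arc_ge hρπ
  have hkey : ENNReal.ofReal (ρ / π) * ν (suOpBall N ρ) ≤ ENNReal.ofReal ((20 * ρ) ^ (N * N)) := by
    calc ENNReal.ofReal (ρ / π) * ν (suOpBall N ρ) ≤ lam {z : Circle | ‖(z : ℂ) - 1‖ ≤ ρ} * ν (suOpBall N ρ) := by gcongr
      _ ≤ prodHaar N (unitaryOpBall N (2 * ρ)) := hprod
      _ ≤ ENNReal.ofReal ((10 * (2 * ρ)) ^ (N * N)) := hU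
      _ = ENNReal.ofReal ((20 * ρ) ^ (N * N)) := by ring_nf
  have hpos : ENNReal.ofReal (ρ / π) ≠ 0 := by
    rw [ne_eq, ENNReal.ofReal_eq_zero, not_le]; positivity
  calc ν (suOpBall N ρ) = (ENNReal.ofReal (ρ / π))⁻¹ * (ENNReal.ofReal (ρ / π) * ν (suOpBall N ρ)) := by
        rw [← mul_assoc, ENNReal.inv_mul_cancel hpos ENNReal.ofReal_ne_top, one_mul]
    _ ≤ (ENNReal.ofReal (ρ / π))⁻¹ * ENNReal.ofReal ((20 * ρ) ^ (N * N)) := by gcongr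
    _ = ENNReal.ofReal (π / ρ * (20 * ρ) ^ (N * N)) := by
        rw [← ENNReal.ofReal_inv_of_pos (by positivity), ← ENNReal.ofReal_mul (by positivity), inv_div]

/-- The `z`-section of `m⁻¹ B^{U}_ρ` lies in a left translate of `B^{SU}_{2ρ}`. [folklore] -/
theorem section_subset (z : Circle) {ρ : ℝ} {V₀ : Matrix.specialUnitaryGroup (Fin N) ℂ}
    (hV₀ : ‖(z : ℂ) • (V₀ : Matrix (Fin N) (Fin N) ℂ) - 1‖ ≤ ρ) :
    {V : Matrix.specialUnitaryGroup (Fin N) ℂ | ‖(z : ℂ) • (V : Matrix (Fin N) (Fin N) ℂ) - 1‖ ≤ ρ} ⊆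
      (fun V => V₀⁻¹ * V) ⁻¹' suOpBall N (2 * ρ) := by
  intro V hV
  simp only [Set.mem_setOf_eq] at hV
  rw [Set.mem_preimage, suOpBall, Set.mem_setOf_eq]
  have hstar : ((V₀⁻¹ * V : Matrix.specialUnitaryGroup (Fin N) ℂ) : Matrix (Fin N) (Fin N) ℂ) =
      star (V₀ : Matrix (Fin N) (Fin N) ℂ) * (V : Matrix (Fin N) (Fin N) ℂ) := by
    rw [← Matrix.star_eq_inv]; rfl
  have hV₀u : (V₀ : Matrix (Fin N) (Fin N) ℂ) ∈ Matrix.unitaryGroup (Fin N) ℂ := (Matrix.mem_specialUnitaryGroup_iff.1 V₀.2).1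
  have h1 : star (V₀ : Matrix (Fin N) (Fin N) ℂ) * (V : Matrix (Fin N) (Fin N) ℂ) - 1 =
      star (V₀ : Matrix (Fin N) (Fin N) ℂ) * ((V : Matrix (Fin N) (Fin N) ℂ) - V₀) := by
    rw [mul_sub, Matrix.mem_unitaryGroup_iff'.1 hV₀u]
  rw [hstar, h1, CStarRing.norm_mem_unitary_mul _ (Unitary.star_mem hV₀u)]
  have h2 : (V : Matrix (Fin N) (Fin N) ℂ) - V₀ = (z⁻¹ : Circle) • (((z : ℂ) • (V : Matrix (Fin N) (Fin N) ℂ) - 1) -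
      ((z : ℂ) • (V₀ : Matrix (Fin N) (Fin N) ℂ) - 1)) := by
    rw [sub_sub_sub_cancel_right, ← smul_sub, Circle.smul_def, smul_smul, Circle.coe_inv,
      inv_mul_cancel₀ (Circle.coe_ne_zero z), one_smul]
  rw [h2, Circle.smul_def, norm_smul, Circle.norm_coe, one_mul]
  calc ‖((z : ℂ) • (V : Matrix (Fin N) (Fin N) ℂ) - 1) - ((z : ℂ) • (V₀ : Matrix (Fin N) (Fin N) ℂ) - 1)‖
      ≤ ‖(z : ℂ) • (V : Matrix (Fin N) (Fin N) ℂ) - 1‖ + ‖(z : ℂ) • (V₀ : Matrix (Fin N) (Fin N) ℂ) - 1‖ := norm_sub_le _ _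
    _ ≤ ρ + ρ := add_le_add hV hV₀
    _ = 2 * ρ := by ring

/-- The `z`-section is empty unless `|z^N − 1| ≤ (Nπ/2) ρ` (`ρ < 2`; the determinant lemma). [folklore] -/
theorem norm_pow_sub_one_le_of_section {z : Circle} {ρ : ℝ} (hρ : ρ < 2) {V : Matrix.specialUnitaryGroup (Fin N) ℂ}
    (hV : ‖(z : ℂ) • (V : Matrix (Fin N) (Fin N) ℂ) - 1‖ ≤ ρ) : ‖(z : ℂ) ^ N - 1‖ ≤ N * π / 2 * ρ := by
  have h := norm_det_sub_one_le (toUnitary (z, V)) (by rw [coe_toUnitary]; exact hV.trans_lt hρ)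
  rw [det_toUnitary, coe_toUnitary] at h
  exact h.trans (mul_le_mul_of_nonneg_left hV (by positivity))

/-- ★★ **LOWER small-ball bound on `SU(N)`**: for `N ≥ 1` and `0 < ρ < 2`,
`(ρ/(2π + ρ))^{N²} ≤ (Nπρ/4) · ν{V ∈ SU(N) : ‖V − 1‖_op ≤ 2ρ}`. [folklore] -/
theorem haar_suOpBall_ge (hN : N ≠ 0) {ρ : ℝ} (hρ : 0 < ρ) (hρ2 : ρ < 2) :
    ENNReal.ofReal ((ρ / (2 * π + ρ)) ^ (N * N)) ≤
      ENNReal.ofReal (N * π * ρ / 4) * haarProbability (Matrix.specialUnitaryGroup (Fin N) ℂ) (suOpBall N (2 * ρ)) := by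
  set lam := haarProbability Circle
  set ν := haarProbability (Matrix.specialUnitaryGroup (Fin N) ℂ)
  haveI := secondCountable_su N
  haveI := isProbabilityMeasure_prodHaar N
  haveI := isMulLeftInvariant_prodHaar hN
  haveI := isMulLeftInvariant_haarProbability (Matrix.specialUnitaryGroup (Fin N) ℂ)
  have hU : ENNReal.ofReal ((ρ / (2 * π + ρ)) ^ (N * N)) ≤ prodHaar N (unitaryOpBall N ρ) :=
    haar_unitaryOpBall_ge _ hρ
  set E : Set (Circle × Matrix.specialUnitaryGroup (Fin N) ℂ) := toUnitary ⁻¹' unitaryOpBall N ρ with hE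
  have hEmeas : MeasurableSet E := (measurableSet_unitaryOpBall ρ).preimage continuous_toUnitary.measurable
  have hprod : prodHaar N (unitaryOpBall N ρ) = ∫⁻ z, ν (Prod.mk z ⁻¹' E) ∂lam := by
    rw [prodHaar, Measure.map_apply continuous_toUnitary.measurable (measurableSet_unitaryOpBall _),
      Measure.prod_apply hEmeas]
  -- the arc where the section can be non-empty
  set Z : Set Circle := (fun z : Circle => z ^ N) ⁻¹' {w : Circle | ‖(w : ℂ) - 1‖ ≤ N * π / 2 * ρ} with hZ
  have hZmeas : MeasurableSet Z := (measurableSet_arc _).preimage (continuous_pow N).measurable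
  have hsec : ∀ z, ν (Prod.mk z ⁻¹' E) ≤ Z.indicator (fun _ => ν (suOpBall N (2 * ρ))) z := by
    intro z
    by_cases hne : (Prod.mk z ⁻¹' E).Nonempty
    · obtain ⟨V₀, hV₀⟩ := hne
      have hV₀' : ‖(z : ℂ) • (V₀ : Matrix (Fin N) (Fin N) ℂ) - 1‖ ≤ ρ := by
        simpa [hE, mem_unitaryOpBall] using hV₀
      have hzZ : z ∈ Z := by
        simp only [hZ, Set.mem_preimage, Set.mem_setOf_eq, Circle.coe_pow]
        exact norm_pow_sub_one_le_of_section hρ2 hV₀'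
      rw [Set.indicator_of_mem hzZ]
      have hsub : Prod.mk z ⁻¹' E ⊆ (fun V => V₀⁻¹ * V) ⁻¹' suOpBall N (2 * ρ) := by
        intro V hV
        have hV' : ‖(z : ℂ) • (V : Matrix (Fin N) (Fin N) ℂ) - 1‖ ≤ ρ := by
          simpa [hE, mem_unitaryOpBall] using hV
        exact section_subset z hV₀' hV'
      calc ν (Prod.mk z ⁻¹' E) ≤ ν ((fun V => V₀⁻¹ * V) ⁻¹' suOpBall N (2 * ρ)) := measure_mono hsub
        _ = ν (suOpBall N (2 * ρ)) := measure_preimage_mul ν _ _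
    · rw [Set.not_nonempty_iff_eq_empty.1 hne, measure_empty]
      exact bot_le
  have hint : ∫⁻ z, ν (Prod.mk z ⁻¹' E) ∂lam ≤ ν (suOpBall N (2 * ρ)) * lam Z := by
    calc ∫⁻ z, ν (Prod.mk z ⁻¹' E) ∂lam ≤ ∫⁻ z, Z.indicator (fun _ => ν (suOpBall N (2 * ρ))) z ∂lam :=
          lintegral_mono hsec
      _ = ν (suOpBall N (2 * ρ)) * lam Z := lintegral_indicator_const hZmeas _
  -- `λ(Z) = λ(arc) ≤ Nπρ/4`
  have hZle : lam Z ≤ ENNReal.ofReal (N * π * ρ / 4) := by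
    have h1 : lam Z = (lam.map fun z : Circle => z ^ N) {w : Circle | ‖(w : ℂ) - 1‖ ≤ N * π / 2 * ρ} := by
      rw [Measure.map_apply (continuous_pow N).measurable (measurableSet_arc _)]
    rw [h1, map_pow_haar_circle hN]
    refine (haar_circle_arc_le _).trans (le_of_eq ?_)
    congr 1; ring
  calc ENNReal.ofReal ((ρ / (2 * π + ρ)) ^ (N * N)) ≤ prodHaar N (unitaryOpBall N ρ) := hU
    _ = ∫⁻ z, ν (Prod.mk z ⁻¹' E) ∂lam := hprod
    _ ≤ ν (suOpBall N (2 * ρ)) * lam Z := hint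
    _ ≤ ν (suOpBall N (2 * ρ)) * ENNReal.ofReal (N * π * ρ / 4) := by gcongr
    _ = _ := mul_comm _ _

/-- ★★ The lower bound solved for the ball: for `N ≥ 1`, `0 < ρ < 2`,
`ν{V ∈ SU(N) : ‖V − 1‖_op ≤ 2ρ} ≥ (4/(Nπρ)) (ρ/(2π + ρ))^{N²}`. [folklore] -/
theorem haar_suOpBall_ge' (hN : N ≠ 0) {ρ : ℝ} (hρ : 0 < ρ) (hρ2 : ρ < 2) :
    ENNReal.ofReal (4 / (N * π * ρ) * (ρ / (2 * π + ρ)) ^ (N * N)) ≤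
      haarProbability (Matrix.specialUnitaryGroup (Fin N) ℂ) (suOpBall N (2 * ρ)) := by
  have h := haar_suOpBall_ge hN hρ hρ2
  have hNpos : (0 : ℝ) < N := by exact_mod_cast Nat.pos_of_ne_zero hN
  have hc : (0 : ℝ) < N * π * ρ / 4 := by positivity
  have hpos : ENNReal.ofReal (N * π * ρ / 4) ≠ 0 := by
    rw [ne_eq, ENNReal.ofReal_eq_zero, not_le]; exact hc
  calc ENNReal.ofReal (4 / (N * π * ρ) * (ρ / (2 * π + ρ)) ^ (N * N))
      = (ENNReal.ofReal (N * π * ρ / 4))⁻¹ * ENNReal.ofReal ((ρ / (2 * π + ρ)) ^ (N * N)) := by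
        rw [← ENNReal.ofReal_inv_of_pos hc, ← ENNReal.ofReal_mul (by positivity)]
        congr 1; field_simp
    _ ≤ (ENNReal.ofReal (N * π * ρ / 4))⁻¹ * (ENNReal.ofReal (N * π * ρ / 4) *
          haarProbability (Matrix.specialUnitaryGroup (Fin N) ℂ) (suOpBall N (2 * ρ))) := by gcongr
    _ = haarProbability (Matrix.specialUnitaryGroup (Fin N) ℂ) (suOpBall N (2 * ρ)) := by
        rw [← mul_assoc, ENNReal.inv_mul_cancel hpos ENNReal.ofReal_ne_top, one_mul]

end SmallBall

end SUHaar

end Summit.QuantumFields.GaugeBoot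

end
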